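import Summits.CriticalPhenomena.PercolationContinuityZ3.Theorems.PercNearOneGluingNoHeavyPcintNawFreeZ3F12Check1
import Summits.CriticalPhenomena.PercolationContinuityZ3.Theorems.PercNearOneGluingNoHeavyPcintNawFreeZ3F12Check2
import Summits.CriticalPhenomena.PercolationContinuityZ3.Theorems.PercNearOneGluingNoHeavyPcintNawFreeZ3F12Check3
import Summits.CriticalPhenomena.PercolationContinuityZ3.Theorems.PercNearOneGluingNoHeavyPcintNawFreeZ3F12Check4
import Summits.CriticalPhenomena.PercolationContinuityZ3.Theorems.PercNearOneGluingNoHeavyPcintNawFreeZ3F12Check5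
import Summits.CriticalPhenomena.PercolationContinuityZ3.Theorems.PercNearOneGluingNoHeavyPcintNawFreeZ3F12Check6
import Summits.CriticalPhenomena.PercolationContinuityZ3.Theorems.PercNearOneGluingNoHeavyPcintNawFreeZ3F12Check7
import Summits.CriticalPhenomena.PercolationContinuityZ3.Theorems.PercNearOneGluingNoHeavyPcintNawFreeZ3F12Check8
import Summits.CriticalPhenomena.PercolationContinuityZ3.Theorems.PercNearOneGluingNoHeavyPcintNawFreeZ3F12Check9
import Summits.CriticalPhenomena.PercolationContinuityZ3.Theorems.PercNearOneGluingNoHeavyPcintNawFreeZ3F12Check10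
import HarnessLib

/-!
# PCINT lane, kernel reduced-state B2d (`nawfree`) certificate `Z3F12` (d = 3, memory τ = 12, delay kt = 4, 3907 state classes): the theorem

Cell `prim-pcint`, seat `prim-pcint-1` (gen 6); memo `run/shared/lean/prim/pcint/REDUCTIONS.md` §B2d (delayed chain payments with
free-neighbour shares).  Does NOT build on p205010.  Data for `NawK.le_siteCriticalProb_of_checkRowsF` (`…PcintNawFreeMemKernelCert`):
`p = 25670/100000`, weight table `Q_k/100000`, `Q = [74330, 74330, 86215, 90585, 92852, 94240, 95176]` (`Q_k^k·100000 ≥ (100000-25670)·100000^k`, nondecreasing), `λ = 99999/100000`; Collatz–Wielandt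
weights (scale 10⁹) from a power iteration, exact off-line max row ratio 0.9998013671 < λ.  Generated by work/gen6/gen_free.py
(pcint-1 gen 6 folder); the kernel re-checks every row.
-/

namespace Summit.CriticalPhenomena.PercolationContinuityZ3.Theorems.Pcint

open Literature.Probability.Percolation Literature.Probability.LatticeModels

/-- Every row of the certificate passes. [folklore] -/
theorem NawFreeZ3F12.all_rows : WinK.allRange (NawK.checkRowF 12 4 3 3907 25670 100000 99999 100000 NawFreeZ3F12.QL NawFreeZ3F12.syms NawFreeZ3F12.tree) 0 3907 = true := (WinK.allRange_split (WinK.allRange_split (WinK.allRange_split (WinK.allRange_split (WinK.allRange_split (WinK.allRange_split (WinK.allRange_split (WinK.allRange_split (WinK.allRange_split NawFreeZ3F12.file_1 NawFreeZ3F12.file_2) NawFreeZ3F12.file_3) NawFreeZ3F12.file_4) NawFreeZ3F12.file_5) NawFreeZ3F12.file_6) NawFreeZ3F12.file_7) NawFreeZ3F12.file_8) NawFreeZ3F12.file_9) NawFreeZ3F12.file_10)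


/-- **`p_c^site(ℤ^3) ≥ 0.2567`** (kernel-checked reduced-state B2d certificate: delayed chain payments with free-neighbour shares on the
memory-`12` dangerous-set automaton, delay kt = 4, 3907 state classes, `decide +kernel` only). [folklore] -/
theorem siteCriticalProb_Z3_ge_02567_free : (0.2567 : ℝ) ≤ siteCriticalProb (zdGraph 3) 0 := by
  have h := NawK.le_siteCriticalProb_of_checkRowsF (d := 3) (τ := 12) (kt := 4) (N := 3907) (pn := 25670) (D := 100000)
    (lamN := 99999) (lamD := 100000) (QL := NawFreeZ3F12.QL) (syms := NawFreeZ3F12.syms) (t := NawFreeZ3F12.tree)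
    (by norm_num) (by norm_num) (by norm_num)
    (fun c => NawK.symOfTab 3 (NawFreeZ3F12.syms.getD c [])) (NawK.syms_spec_of_valid NawFreeZ3F12.syms_valid)
    (fun i hi => WinK.of_allRange NawFreeZ3F12.all_rows (Nat.zero_le i) hi)
    (by norm_num) (by decide +kernel) (by norm_num) (by norm_num) (by decide +kernel) (by norm_num)
  have e : ((25670 : ℕ) : ℝ) / ((100000 : ℕ) : ℝ) = (0.2567 : ℝ) := by norm_num
  rw [e] at h
  exact h

end Summit.CriticalPhenomena.PercolationContinuityZ3.Theorems.Pcint
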